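import Literature.AlgebraicGeometry.Resolution.Alterations
import Literature.AlgebraicGeometry.Resolution.SmoothStalksRegular
import Literature.AlgebraicGeometry.Morphisms.FiniteOfClosedFibres
import Mathlib.AlgebraicGeometry.Morphisms.Etale
import HarnessLib

/-!
# Fibres over the finite étale locus of a morphism: base change into the locus, reduced fibres,
# and alterations from finite non-empty closed fibres (Harris Prop. 7.16; de Jong 2.20; EGA IV₄ 17.6)

Layer `Literature/AlgebraicGeometry/Morphisms`, namespace `Literature.AlgebraicGeometry.Morphisms`.  KERNEL ONLY:
theorems; no definition, no named fact, no instance, no `sorry`.  Generic (any schemes; the field `Ω` arbitrary).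

For a morphism `ψ : T ⟶ S` and an open `V ⊆ S` this file packages the three elementary facts that turn «`ψ` is finite
étale over the dense open `V`» (the output of generic étaleness in characteristic `0`, [Harris1992] Prop. 7.16 / EGA IV₄
17.6.1) into statements about the FIBRES of `ψ` itself:

* §1 **base change INTO the locus**: if `ψ ∣_ V` has a property `P` stable under base change (finite, étale, …), then so
  does the base change `p : T ×_S W ⟶ W` of `ψ` along ANY `g : W ⟶ S` whose image lies in `V`
  (`of_isPullback_of_range_subset`, `etale_of_isPullback_of_range_subset`, `isFinite_of_isPullback_of_range_subset`) —
  the pull-back square is pasted from `T ×_S W → ψ⁻¹V → T` (Mathlib `IsPullback.of_right'`, `isPullback_morphismRestrict`);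
* §2 **fibres over the étale locus are reduced**: for a field-valued point `sb : Spec Ω ⟶ S` landing in `V` every pull-back
  of `ψ` along `sb` is a REDUCED scheme (`isReduced_of_isPullback_of_range_subset`, `isReduced_pullback_of_range_subset`,
  and for scheme points `isReduced_fiber_of_mem : s ∈ V → IsReduced (ψ.fiber s)`) — étale over a field is smooth over a
  field, hence reduced (★ `Resolution.isReduced_of_smooth`);
* §3 **alterations from finite non-empty closed fibres**: a proper morphism from an integral scheme to an irreducible
  Jacobson scheme whose fibres over the CLOSED points of a non-empty open `U` are finite and non-empty is an ALTERATION
  (★ `Resolution.IsAlteration`: integral source, proper, dominant, finite over a non-empty open) —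
  `isFinite_morphismRestrict_of_finite_preimage_of_isClosed` (proper + finite closed fibres ⇒ finite, ★
  `isFinite_of_isProper_of_finite_preimage_closedPoint`, on `ψ ∣_ U`), `isDominant_of_nonempty_preimage_of_isClosed`,
  `isAlteration_of_finite_nonempty_preimage_of_isClosed`;
* §4 the **(P2) socket shape** `exists_opens_finite_etale_isReduced_of_core`: §3 + generic étaleness of alterations (taken as the
  hypothesis `hcore`, a sibling file's theorem in characteristic `0`) + §2 ⇒ a non-empty open `V` over which `ψ` is finite
  étale with all fibres and all field-valued pull-backs reduced.

Consumer (cell `hodgecm-mathlib`, D-0151, road G4∕(E) for [Lange2023AbelianVarietiesComplex] Lemma 4.4.4 Step I = [Milne1986JacobianVarieties]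
Lemma 6.7 «multiplicity one»): the incidence `ψ : C × W̃_{g−1} → J` of a smooth projective complex curve has exactly the
`g` points of `D(a)` over a general `a ∈ J(ℂ)`, so §3 makes it an alteration, generic étaleness (char `0`) gives the
finite étale locus `V`, and §2 says the fibre `ψ⁻¹(a) = Z(α_c^* Θ_a)` is reduced for `a ∈ V(ℂ)` — every intersection
multiplicity is `1`.  COUNT-NEUTRAL.  HC_CM is proved only modulo the 7 printed citations until rung 0 closes.

## References
* [Harris1992] J. Harris, *Algebraic Geometry: A First Course*, GTM 133 (1992), Prop. 7.16 (p. 80).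
* [DeJong1996] A. J. de Jong, *Smoothness, semi-stability and alterations*, Publ. Math. IHÉS 83 (1996), 2.20 (p. 61),
  proof of Lemma 4.13 (p. 70).
* [Grothendieck1967] A. Grothendieck, J. Dieudonné, EGA IV₄, Publ. Math. IHÉS 32 (1967), Thm. 17.6.1.
-/

set_option autoImplicit false

noncomputable section

universe u

open CategoryTheory CategoryTheory.Limits AlgebraicGeometry TopologicalSpace Topology

namespace Literature.AlgebraicGeometry.Morphisms

variable {T S : Scheme.{u}} (ψ : T ⟶ S) (V : S.Opens)

/-! ## §1 Base change into the locus `V` -/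

section BaseChange

variable {W P : Scheme.{u}} {g : W ⟶ S} {t : P ⟶ T} {p : P ⟶ W}

/-- A morphism `g : W ⟶ S` whose image lies in the open `V` factors through `V` (Mathlib `IsOpenImmersion.lift`); the
factorisation composed with `V.ι` is `g`. [cite: Grothendieck1967, Thm. 17.6.1] -/
theorem lift_opens_ι_fac (hg : Set.range g.base ⊆ (V : Set S)) :
    IsOpenImmersion.lift V.ι g (by rwa [Scheme.Opens.range_ι]) ≫ V.ι = g :=
  IsOpenImmersion.lift_fac _ _ _

/-- **Base change into the locus.**  Let `P` be a property of morphisms of schemes stable under base change.  If `ψ ∣_ V`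
has `P` and `g : W ⟶ S` has image in `V`, then for every pull-back square `P' = T ×_S W` the projection `p : P' ⟶ W`
has `P`: the square is the pasting of `P' → ψ⁻¹V → T` over `W → V → S`, whose right half `ψ⁻¹ V = T ×_S V` is
cartesian (Mathlib `isPullback_morphismRestrict`), so its left half is cartesian (`IsPullback.of_right'`) and exhibits
`p` as a base change of `ψ ∣_ V`. [cite: Grothendieck1967, Thm. 17.6.1] -/
theorem of_isPullback_of_range_subset (Q : MorphismProperty Scheme.{u}) [Q.IsStableUnderBaseChange]
    (hV : Q (ψ ∣_ V)) (hg : Set.range g.base ⊆ (V : Set S)) (sq : IsPullback t p ψ g) : Q p := by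
  have hr : IsPullback (ψ ⁻¹ᵁ V).ι (ψ ∣_ V) ψ V.ι := (isPullback_morphismRestrict ψ V).flip
  have sq' : IsPullback t p ψ (IsOpenImmersion.lift V.ι g (by rwa [Scheme.Opens.range_ι]) ≫ V.ι) := by
    rw [lift_opens_ι_fac V hg]
    exact sq
  exact Q.of_isPullback (IsPullback.of_right' sq' hr) hV

/-- **Étale over `V` ⇒ étale after any base change into `V`.** [cite: Grothendieck1967, Thm. 17.6.1] -/
theorem etale_of_isPullback_of_range_subset [Etale (ψ ∣_ V)] (hg : Set.range g.base ⊆ (V : Set S))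
    (sq : IsPullback t p ψ g) : Etale p :=
  of_isPullback_of_range_subset ψ V @Etale ‹_› hg sq

/-- **Finite over `V` ⇒ finite after any base change into `V`.** [cite: Grothendieck1967, Thm. 17.6.1] -/
theorem isFinite_of_isPullback_of_range_subset [IsFinite (ψ ∣_ V)] (hg : Set.range g.base ⊆ (V : Set S))
    (sq : IsPullback t p ψ g) : IsFinite p :=
  of_isPullback_of_range_subset ψ V @IsFinite ‹_› hg sq

/-- The chosen pull-back `pullback ψ g ⟶ W` is étale when `ψ` is étale over `V ⊇ im g`. [cite: Grothendieck1967, Thm. 17.6.1] -/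
theorem etale_pullback_snd_of_range_subset [Etale (ψ ∣_ V)] (g : W ⟶ S) (hg : Set.range g.base ⊆ (V : Set S)) :
    Etale (pullback.snd ψ g) :=
  etale_of_isPullback_of_range_subset ψ V hg (IsPullback.of_hasPullback ψ g)

/-- The chosen pull-back `pullback ψ g ⟶ W` is finite when `ψ` is finite over `V ⊇ im g`. [cite: Grothendieck1967, Thm. 17.6.1] -/
theorem isFinite_pullback_snd_of_range_subset [IsFinite (ψ ∣_ V)] (g : W ⟶ S) (hg : Set.range g.base ⊆ (V : Set S)) :
    IsFinite (pullback.snd ψ g) :=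
  isFinite_of_isPullback_of_range_subset ψ V hg (IsPullback.of_hasPullback ψ g)

end BaseChange

/-! ## §2 Fibres over the étale locus are reduced -/

section Fibres

variable {Ω : Type u} [Field Ω]

/-- **A pull-back of `ψ` along a field-valued point of the étale locus is reduced**: for `sb : Spec Ω ⟶ S` with image in
`V` and any cartesian square `P = T ×_S Spec Ω`, the scheme `P` is reduced — it is étale, in particular smooth, over the
field `Ω` (★ `Resolution.isReduced_of_smooth`).  With `Ω` algebraically closed this is «a general fibre of a generically
finite separable morphism consists of REDUCED points» ([Harris1992] Prop. 7.16). [cite: Harris1992, Prop. 7.16 (p. 80)]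
[cite: Grothendieck1967, Thm. 17.6.1] -/
theorem isReduced_of_isPullback_of_range_subset [Etale (ψ ∣_ V)] {P : Scheme.{u}} {sb : Spec (.of Ω) ⟶ S}
    (hs : Set.range sb.base ⊆ (V : Set S)) {t : P ⟶ T} {p : P ⟶ Spec (.of Ω)} (sq : IsPullback t p ψ sb) :
    IsReduced P :=
  haveI : Etale p := etale_of_isPullback_of_range_subset ψ V hs sq
  Resolution.isReduced_of_smooth p

/-- The chosen fibre `pullback ψ sb` over a field-valued point of the étale locus is reduced. [cite: Harris1992, Prop. 7.16 (p. 80)] -/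
theorem isReduced_pullback_of_range_subset [Etale (ψ ∣_ V)] (sb : Spec (.of Ω) ⟶ S)
    (hs : Set.range sb.base ⊆ (V : Set S)) : IsReduced (pullback ψ sb : Scheme.{u}) :=
  isReduced_of_isPullback_of_range_subset ψ V hs (IsPullback.of_hasPullback ψ sb)

/-- A field-valued point `sb : Spec Ω ⟶ S` lands in `V` as soon as its image point does. [cite: Grothendieck1967, Thm. 17.6.1] -/
theorem range_subset_of_apply_closedPoint_mem (sb : Spec (.of Ω) ⟶ S)
    (hs : sb.base (IsLocalRing.closedPoint Ω) ∈ V) : Set.range sb.base ⊆ (V : Set S) := by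
  rintro _ ⟨x, rfl⟩
  rwa [Subsingleton.elim x (IsLocalRing.closedPoint Ω)]

/-- **The scheme-theoretic fibre `ψ⁻¹(s) = T ×_S Spec κ(s)` over a point `s` of the étale locus is reduced**
(Mathlib `Scheme.Hom.fiber`; cf. ★ `Resolution.isReduced_fiber_of_etale` for a globally étale morphism).
[cite: Harris1992, Prop. 7.16 (p. 80)] [cite: Grothendieck1967, Thm. 17.6.1] -/
theorem isReduced_fiber_of_mem [Etale (ψ ∣_ V)] {s : S} (hs : s ∈ V) : IsReduced (ψ.fiber s : Scheme.{u}) := by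
  have hr : Set.range (S.fromSpecResidueField s).base ⊆ (V : Set S) := by
    rintro _ ⟨x, rfl⟩
    rw [Scheme.fromSpecResidueField_apply]
    exact hs
  haveI : Etale (ψ.fiberToSpecResidueField s) := by
    delta Scheme.Hom.fiberToSpecResidueField Scheme.Hom.fiber
    exact etale_pullback_snd_of_range_subset ψ V _ hr
  have hsm : Smooth (ψ.fiberToSpecResidueField s) := inferInstance
  exact @Resolution.isReduced_of_smooth (S.residueField s) _ (ψ.fiber s) (ψ.fiberToSpecResidueField s) hsm

end Fibres

/-! ## §3 Alterations from finite non-empty closed fibres -/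

section Alteration

/-- The fibre of `ψ ∣_ U` over `u ∈ U` is carried bijectively onto the fibre of `ψ` over `u` by the inclusion
`ψ⁻¹ U ⊆ T`; in particular it is finite when the latter is. [cite: DeJong1996, Lemma 4.13 (proof), p. 70] -/
theorem finite_preimage_morphismRestrict_of_finite (U : S.Opens) (u : U)
    (h : (ψ.base ⁻¹' {(u : S)}).Finite) : ((ψ ∣_ U).base ⁻¹' {u}).Finite := by
  refine Set.Finite.of_finite_image (f := fun x : ↥(ψ ⁻¹ᵁ U) => (x : T)) ?_ Subtype.val_injective.injOn
  refine h.subset ?_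
  rintro _ ⟨x, hx, rfl⟩
  have hx' : (ψ ∣_ U).base x = u := hx
  change ψ.base x.1 = u.1
  rw [← morphismRestrict_base_coe ψ U x, hx']

/-- **Proper with finite fibres over the closed points of an open `U` ⇒ finite over `U`** (`S` Jacobson, so the closed
points of `U` are closed in `S`; ★ `isFinite_of_isProper_of_finite_preimage_closedPoint` = proper + quasi-finite is finite,
applied to `ψ ∣_ U`). [cite: DeJong1996, Lemma 4.13 (proof), p. 70] -/
theorem isFinite_morphismRestrict_of_finite_preimage_of_isClosed [IsProper ψ] [JacobsonSpace S] (U : S.Opens)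
    (h : ∀ s : S, s ∈ U → IsClosed ({s} : Set S) → (ψ.base ⁻¹' {s}).Finite) : IsFinite (ψ ∣_ U) := by
  haveI : JacobsonSpace U := JacobsonSpace.of_isOpenEmbedding U.ι.isOpenEmbedding
  refine isFinite_of_isProper_of_finite_preimage_closedPoint (ψ ∣_ U) fun u hu => ?_
  refine finite_preimage_morphismRestrict_of_finite ψ U u (h u.1 u.2 ?_)
  have h1 : u ∈ U.ι.base ⁻¹' closedPoints S := by
    rw [U.ι.isOpenEmbedding.preimage_closedPoints]
    exact hu
  simpa using h1

/-- **Non-empty fibres over the closed points of a non-empty open ⇒ dominant** (`S` Jacobson and irreducible: the closed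
points of `U` are dense in `U`, which is dense in `S`). [cite: DeJong1996, 2.20, p. 61] -/
theorem isDominant_of_nonempty_preimage_of_isClosed [JacobsonSpace S] [IrreducibleSpace S] (U : S.Opens)
    (hU : (U : Set S).Nonempty) (h : ∀ s : S, s ∈ U → IsClosed ({s} : Set S) → (ψ.base ⁻¹' {s}).Nonempty) :
    IsDominant ψ := by
  refine ⟨dense_iff_closure_eq.mpr ?_⟩
  -- the closed points of `U` lie in the image
  have hsub : (U : Set S) ∩ closedPoints S ⊆ Set.range ψ.base := by
    rintro s ⟨hsU, hscl⟩
    obtain ⟨x, hx⟩ := h s hsU hscl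
    exact ⟨x, hx⟩
  have hcl : closure ((U : Set S) ∩ closedPoints S) = closure (U : Set S) :=
    JacobsonSpace.closure_inter_closedPoints_eq_closure U.2.isLocallyClosed
  have hUd : closure (U : Set S) = Set.univ :=
    dense_iff_closure_eq.mp (U.2.dense hU)
  refine Set.eq_univ_of_univ_subset ?_
  rw [← hUd, ← hcl]
  exact closure_mono hsub

/-- **A proper morphism from an integral scheme to an irreducible Jacobson scheme whose fibres over the closed points of
a non-empty open `U` are finite and non-empty is an ALTERATION** (★ `Resolution.IsAlteration`: integral source, proper,
dominant, finite over a non-empty open).  The use: an incidence correspondence whose general fibre is a known finite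
non-empty set of points. [cite: DeJong1996, 2.20, p. 61] -/
theorem isAlteration_of_finite_nonempty_preimage_of_isClosed [IsIntegral T] [IsProper ψ] [JacobsonSpace S]
    [IrreducibleSpace S] (U : S.Opens) (hU : (U : Set S).Nonempty)
    (hfin : ∀ s : S, s ∈ U → IsClosed ({s} : Set S) → (ψ.base ⁻¹' {s}).Finite)
    (hne : ∀ s : S, s ∈ U → IsClosed ({s} : Set S) → (ψ.base ⁻¹' {s}).Nonempty) :
    Resolution.IsAlteration ψ where
  isIntegral := ‹_›
  isProper := ‹_›
  isDominant := isDominant_of_nonempty_preimage_of_isClosed ψ U hU hne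
  exists_isFinite := ⟨U, hU, isFinite_morphismRestrict_of_finite_preimage_of_isClosed ψ U hfin⟩

end Alteration


/-! ## §4 The (P2) socket of Step I: reduced general fibres of an incidence, given generic étaleness of alterations -/

section Socket

/-- **(P2) SOCKET SHAPE.**  Let `ψ : T ⟶ S` be proper from an integral scheme to an irreducible Jacobson scheme, with
finite non-empty fibres over the closed points of a non-empty open `U` (so `ψ` is an alteration, §3), and GRANT generic
étaleness of this alteration (`hcore`: «∃ a non-empty open `V` over which `ψ` is finite étale» — in characteristic `0`
the theorem of de Jong 2.20 ∕ EGA IV₄ 17.6.1, supplied by a sibling file).  Then there is a non-empty open `V ⊆ S` over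
which `ψ` is finite étale and over whose field-valued points EVERY pull-back of `ψ` is reduced — «a general fibre
consists of reduced points». [cite: Harris1992, Prop. 7.16 (p. 80)] [cite: DeJong1996, 2.20, p. 61] -/
theorem exists_opens_finite_etale_isReduced_of_core [IsIntegral T] [IsProper ψ] [JacobsonSpace S] [IrreducibleSpace S]
    (hcore : Resolution.IsAlteration ψ →
      ∃ V : S.Opens, (V : Set S).Nonempty ∧ IsFinite (ψ ∣_ V) ∧ Etale (ψ ∣_ V))
    (U : S.Opens) (hU : (U : Set S).Nonempty)
    (hfin : ∀ s : S, s ∈ U → IsClosed ({s} : Set S) → (ψ.base ⁻¹' {s}).Finite)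
    (hne : ∀ s : S, s ∈ U → IsClosed ({s} : Set S) → (ψ.base ⁻¹' {s}).Nonempty) :
    ∃ V : S.Opens, (V : Set S).Nonempty ∧ IsFinite (ψ ∣_ V) ∧ Etale (ψ ∣_ V) ∧
      (∀ s : S, s ∈ V → IsReduced (ψ.fiber s : Scheme.{u})) ∧
      ∀ (Ω : Type u) [Field Ω] (sb : Spec (.of Ω) ⟶ S),
        sb.base (IsLocalRing.closedPoint Ω) ∈ V → IsReduced (pullback ψ sb : Scheme.{u}) := by
  obtain ⟨V, hV, hfinV, hetV⟩ := hcore (isAlteration_of_finite_nonempty_preimage_of_isClosed ψ U hU hfin hne)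
  exact ⟨V, hV, hfinV, hetV, fun s hs => isReduced_fiber_of_mem ψ V hs,
    fun Ω _ sb hsb => isReduced_pullback_of_range_subset ψ V sb (range_subset_of_apply_closedPoint_mem V sb hsb)⟩

end Socket

end Literature.AlgebraicGeometry.Morphisms

end
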